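import Mathlib
import Summits.NavierStokesRegularity.NavierStokesRegularity.Theorems.ThreadingFluxCentreJetDefs
import Summits.NavierStokesRegularity.NavierStokesRegularity.Theorems.ThreadingFluxCentreJetPolyToolkit
import HarnessLib

/-!
# Crux `PoloidalLiouville` (stmt-NavierStokesRegularity-1222, wall W1), crux idea «steady-centre-sieve» (ns-idea-15 g5):
# A1 `EulerTopFirstIntegrals` — the polynomial first integrals of the Euler top are `ℝ[|y|², ⟪y,Sy⟫]`

`theorem CentreJet.eulerTopFirstIntegrals : EulerTopFirstIntegrals` (Defs twin, body = CentreJetSketch l.282 verbatim):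
for pairwise distinct `aᵢ`, every real polynomial `T` on `ℝ³` with `Σᵢ Wᵢ ∂ᵢ T = 0`, `W = y × S y` the typed
`eulerTopField a`, is `aeval ![rhoPoly, strainPoly a] F` for some `F ∈ ℝ[v₁, v₂]`.

Proof (the card's parity argument, RESULTS §5c, made coordinate-free where possible):
* `L = W·∇` shifts the parity grading of `ℝ[y]` by `(ZMod 2)³ ∋ (1,1,1)`, so `L T = 0` kills every parity class of `T`;
* one chart `Sq : (v₀,v₁,v₂) ↦ (y₀², |y|², ⟪y,Sy⟫)` (= `expand 2 ∘ ψ`, toolkit) satisfies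
  `L ∘ Sq = 2(a₂ − a₁)·y₀y₁y₂ · Sq ∘ ∂_{v₀}` — the generator check is the sketch's pair of guards
  `W·∇|y|² = 0`, `W·∇⟪y,Sy⟫ = 0` plus `W·∇ y₀² = 2(a₂−a₁) y₀y₁y₂`;
* even class: `P = Sq q`, `L P = 0 ⇒ ∂₀ q = 0 ⇒ q ∈ ℝ[v₁,v₂] ⇒ P ∈ ℝ[|y|², ⟪y,Sy⟫]`;
* odd class in `yᵢ₀`: `P²` is even and killed by `L`, so `P² = H(|y|², ⟪y,Sy⟫)`; restricting to `{yᵢ₀ = 0}` kills `P`,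
  hence `H(u_j + u_k, a_j u_j + a_k u_k) = 0` with `a_j ≠ a_k`, hence `H = 0` (the card's transversal hyperplane,
  `cᵢ₀ ≠ 0`), hence `P = 0`.

Information-grade algebra about one crux idea's typed objects (`--supports 1222`); the lemma L1
`TriaxialToroidalJetRigidity` it serves stays a paper lemma; `PoloidalLiouville` (1222) OPEN; NS regularity NOT proved.
ns-wall-eng-5 g5 (cell ns-wall-extremal), 0 kit.
-/

-- the summit and its single sub-problem share the name (CONVENTIONS §1)
set_option linter.dupNamespace false

noncomputable section

namespace Summit.NavierStokesRegularity.NavierStokesRegularity.Theorems.PoloidalLiouville.CentreJet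

open MvPolynomial EulerTop

section Top

variable (a : Fin 3 → ℝ)

/-- `W₀ = (a₂ − a₁) y₁ y₂`. -/
@[simp] theorem eulerTopField_zero : eulerTopField a 0 = C (a 2 - a 1) * X 1 * X 2 := rfl
/-- `W₁ = (a₀ − a₂) y₀ y₂`. -/
@[simp] theorem eulerTopField_one : eulerTopField a 1 = C (a 0 - a 2) * X 0 * X 2 := rfl
/-- `W₂ = (a₁ − a₀) y₀ y₁`. -/
@[simp] theorem eulerTopField_two : eulerTopField a 2 = C (a 1 - a 0) * X 0 * X 1 := rfl

/-- The derivation `L = W·∇ = Σᵢ Wᵢ ∂ᵢ` of the Euler top, as a linear map. -/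
def topL : MvPolynomial (Fin 3) ℝ →ₗ[ℝ] MvPolynomial (Fin 3) ℝ :=
  ∑ i : Fin 3, LinearMap.mulLeft ℝ (eulerTopField a i) ∘ₗ (pderiv i).toLinearMap

/-- `L T = Σᵢ Wᵢ ∂ᵢ T` — the expression in the statement of A1. -/
theorem topL_apply (T : MvPolynomial (Fin 3) ℝ) : topL a T = ∑ i : Fin 3, eulerTopField a i * pderiv i T := by
  simp [topL, LinearMap.sum_apply]

/-- Leibniz rule for `L`. -/
theorem topL_mul (p q : MvPolynomial (Fin 3) ℝ) : topL a (p * q) = p * topL a q + q * topL a p := by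
  simp only [topL_apply, Derivation.leibniz, smul_eq_mul, Fin.sum_univ_three]
  ring

/-- `L` kills constants. -/
@[simp] theorem topL_C (r : ℝ) : topL a (C r) = 0 := by
  simp [topL_apply]

/-- Guard (sketch `eulerTop_rho`): `|y|²` is a first integral. -/
theorem topL_sum_sq : topL a (∑ i : Fin 3, X i ^ 2) = 0 := by
  simp only [topL_apply, Fin.sum_univ_three, map_add, eulerTopField_zero, eulerTopField_one, eulerTopField_two,
    Derivation.leibniz_pow, pderiv_X, Pi.single_apply]
  simp
  ring

/-- Guard (sketch `eulerTop_strain`): `⟪y,Sy⟫` is a first integral. -/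
theorem topL_sum_C_sq : topL a (∑ i : Fin 3, C (a i) * X i ^ 2) = 0 := by
  simp only [topL_apply, Fin.sum_univ_three, map_add, eulerTopField_zero, eulerTopField_one, eulerTopField_two,
    Derivation.leibniz, Derivation.leibniz_pow, pderiv_X, pderiv_C, Pi.single_apply]
  simp
  ring

/-- `L(y₀²) = 2(a₂ − a₁) y₀y₁y₂`. -/
theorem topL_X0_sq : topL a (X 0 ^ 2) = C (2 * (a 2 - a 1)) * X 0 * X 1 * X 2 := by
  simp only [topL_apply, Fin.sum_univ_three, eulerTopField_zero, eulerTopField_one, eulerTopField_two,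
    Derivation.leibniz_pow, pderiv_X, Pi.single_apply, map_mul, map_sub, map_ofNat]
  simp
  ring

/-! ### Parity: `L` shifts the `(ZMod 2)³`-grading by `(1,1,1)` -/

/-- Parity bookkeeping for `W₀`. -/
theorem wAll_add_wPar_zero : wAll + wPar 0 = 0 + wPar 1 + wPar 2 := by
  decide

/-- Parity bookkeeping for `W₁`. -/
theorem wAll_add_wPar_one : wAll + wPar 1 = 0 + wPar 0 + wPar 2 := by
  decide

/-- Parity bookkeeping for `W₂`. -/
theorem wAll_add_wPar_two : wAll + wPar 2 = 0 + wPar 0 + wPar 1 := by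
  decide

/-- `Wᵢ` has parity `(1,1,1) + eᵢ` (it is `cᵢ · Π_{j ≠ i} yⱼ`). -/
theorem isWeightedHomogeneous_eulerTopField :
    ∀ i : Fin 3, IsWeightedHomogeneous wPar (eulerTopField a i) (wAll + wPar i)
  | 0 => by
    rw [eulerTopField_zero, wAll_add_wPar_zero]
    exact ((isWeightedHomogeneous_C wPar (a 2 - a 1)).mul (isWeightedHomogeneous_X ℝ wPar 1)).mul
      (isWeightedHomogeneous_X ℝ wPar 2)
  | 1 => by
    rw [eulerTopField_one, wAll_add_wPar_one]
    exact ((isWeightedHomogeneous_C wPar (a 0 - a 2)).mul (isWeightedHomogeneous_X ℝ wPar 0)).mul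
      (isWeightedHomogeneous_X ℝ wPar 2)
  | 2 => by
    rw [eulerTopField_two, wAll_add_wPar_two]
    exact ((isWeightedHomogeneous_C wPar (a 1 - a 0)).mul (isWeightedHomogeneous_X ℝ wPar 0)).mul
      (isWeightedHomogeneous_X ℝ wPar 1)

/-- `L` maps the parity class `ε` to the class `ε + (1,1,1)`. -/
theorem isWeightedHomogeneous_topL {T : MvPolynomial (Fin 3) ℝ} {ε : Par} (hT : IsWeightedHomogeneous wPar T ε) :
    IsWeightedHomogeneous wPar (topL a T) (ε + wAll) := by
  rw [topL_apply]
  apply IsWeightedHomogeneous.sum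
  intro i _
  have hd : IsWeightedHomogeneous wPar (pderiv i T) (ε + wPar i) := by
    apply isWeightedHomogeneous_pderiv
    rwa [add_assoc, par_add_self, add_zero]
  have h := (isWeightedHomogeneous_eulerTopField a i).mul hd
  have hdeg : wAll + wPar i + (ε + wPar i) = ε + wAll := by
    rw [show wAll + wPar i + (ε + wPar i) = ε + wAll + (wPar i + wPar i) by abel, par_add_self, add_zero]
  rwa [hdeg] at h

/-- `L T = 0` kills every parity class of `T`. -/
theorem topL_parityClass {T : MvPolynomial (Fin 3) ℝ} (hT : topL a T = 0) (ε : Par) :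
    topL a (weightedHomogeneousComponent wPar ε T) = 0 := by
  have h := weightedHomogeneousComponent_sum_shift wAll
    (f := fun δ => topL a (weightedHomogeneousComponent wPar δ T))
    (fun δ => isWeightedHomogeneous_topL a (weightedHomogeneousComponent_isWeightedHomogeneous δ T)) ε
  rw [← map_sum, sum_parity_classes T, hT, map_zero] at h
  exact h.symm

end Top

/-! ### The chart identity `L ∘ Sq = 2(a₂ − a₁) y₀y₁y₂ · Sq ∘ ∂₀` -/

section Chart

variable {a : Fin 3 → ℝ}

/-- The chart identity on the three generators `v₀, v₁, v₂`. -/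
theorem topL_Sq_X (h : a 2 ≠ a 1) (n : Fin 3) :
    topL a (Sq h (X n)) = C (2 * (a 2 - a 1)) * X 0 * X 1 * X 2 * Sq h (pderiv 0 (X n)) := by
  fin_cases n
  · simp [topL_X0_sq]
  · rw [Fin.mk_one, Sq_X1, topL_sum_sq, pderiv_X_of_ne (by decide), map_zero, mul_zero]
  · simp only [Fin.reduceFinMk]
    rw [Sq_X2, topL_sum_C_sq, pderiv_X_of_ne (by decide), map_zero, mul_zero]

/-- **Chart identity** `L(Sq q) = 2(a₂ − a₁)·y₀y₁y₂ · Sq(∂₀ q)` for every `q` (induction on `q`). -/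
theorem topL_Sq (h : a 2 ≠ a 1) (q : MvPolynomial (Fin 3) ℝ) :
    topL a (Sq h q) = C (2 * (a 2 - a 1)) * X 0 * X 1 * X 2 * Sq h (pderiv 0 q) := by
  induction q using MvPolynomial.induction_on with
  | C r => simp [Sq_apply]
  | add p q hp hq => simp only [map_add, hp, hq, mul_add]
  | mul_X p n hp =>
    rw [map_mul, topL_mul, hp, topL_Sq_X h n, Derivation.leibniz]
    simp only [smul_eq_mul, map_add, map_mul]
    ring

/-- On `ℝ[v₁,v₂]` the chart is the substitution `(|y|², ⟪y,Sy⟫)` of the statement. -/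
theorem Sq_rename_succ (h : a 2 ≠ a 1) (H : MvPolynomial (Fin 2) ℝ) :
    Sq h (rename Fin.succ H) = aeval ![rhoPoly, strainPoly a] H := by
  have hc : (Sq h).comp (rename Fin.succ) = aeval ![rhoPoly, strainPoly a] := by
    refine algHom_ext fun i => ?_
    fin_cases i
    · simp [rhoPoly]
    · simp [strainPoly]
  rw [← AlgHom.comp_apply, hc]

/-- `2(a₂ − a₁) y₀y₁y₂ ≠ 0`. -/
theorem topK_ne_zero (h : a 2 ≠ a 1) : C (2 * (a 2 - a 1)) * X 0 * X 1 * X 2 ≠ (0 : MvPolynomial (Fin 3) ℝ) := by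
  have h2 : (2 * (a 2 - a 1)) ≠ 0 := mul_ne_zero two_ne_zero (sub_ne_zero.mpr h)
  exact mul_ne_zero (mul_ne_zero (mul_ne_zero (C_eq_zero.not.mpr h2) (X_ne_zero 0)) (X_ne_zero 1)) (X_ne_zero 2)

/-! ### The even and the odd parity classes -/

/-- Even class: an all-even first integral is a polynomial in `|y|²`, `⟪y,Sy⟫`. -/
theorem exists_aeval_of_even (ha : Function.Injective a) {P : MvPolynomial (Fin 3) ℝ}
    (hP : IsWeightedHomogeneous wPar P 0) (hL : topL a P = 0) :
    ∃ F : MvPolynomial (Fin 2) ℝ, P = aeval ![rhoPoly, strainPoly a] F := by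
  have h21 := ne21_of_injective ha
  obtain ⟨q, hq⟩ := exists_Sq_eq_of_isWeightedHomogeneous_zero h21 hP
  have h0 : pderiv 0 q = 0 := by
    have h1 := topL_Sq h21 q
    rw [hq, hL] at h1
    have h2 := (mul_eq_zero.mp h1.symm).resolve_left (topK_ne_zero h21)
    exact Sq_injective h21 (h2.trans (map_zero _).symm)
  obtain ⟨H, hH⟩ := exists_rename_succ_of_pderiv_zero_eq_zero h0
  exact ⟨H, by rw [← hq, ← hH, Sq_rename_succ]⟩

/-- The two-variable substitution met when an odd class is restricted to `{yᵢ₀ = 0}`. -/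
def reducedPair (a : Fin 3 → ℝ) (i₀ : Fin 3) : MvPolynomial (Fin 2) ℝ →ₐ[ℝ] MvPolynomial (Fin 3) ℝ :=
  aeval ![∑ j : Fin 3, if j = i₀ then 0 else X j, ∑ j : Fin 3, if j = i₀ then 0 else C (a j) * X j]

/-- `(v₁,v₂) ↦ (Σ_{j≠i₀} u_j, Σ_{j≠i₀} a_j u_j)` is injective for pairwise distinct `aᵢ` (the transversal hyperplane). -/
theorem reducedPair_injective (ha : Function.Injective a) (i₀ : Fin 3) : Function.Injective (reducedPair a i₀) := by
  fin_cases i₀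
  · exact injective_of_pair (j := 1) (k := 2) (by decide) (fun h => absurd (ha h) (by decide)) _
      (by simp [reducedPair, Fin.sum_univ_three]) (by simp [reducedPair, Fin.sum_univ_three])
  · exact injective_of_pair (j := 0) (k := 2) (by decide) (fun h => absurd (ha h) (by decide)) _
      (by simp [reducedPair, Fin.sum_univ_three]) (by simp [reducedPair, Fin.sum_univ_three])
  · exact injective_of_pair (j := 0) (k := 1) (by decide) (fun h => absurd (ha h) (by decide)) _
      (by simp [reducedPair, Fin.sum_univ_three]) (by simp [reducedPair, Fin.sum_univ_three])

/-- Restricting the substitution `(|y|², ⟪y,Sy⟫)` to `{yᵢ₀ = 0}`. -/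
theorem kill_comp_aeval (a : Fin 3 → ℝ) (i₀ : Fin 3) :
    (aeval fun j : Fin 3 => if j = i₀ then (0 : MvPolynomial (Fin 3) ℝ) else X j).comp
        (aeval ![rhoPoly, strainPoly a]) = (expand 2).comp (reducedPair a i₀) := by
  refine algHom_ext fun i => ?_
  fin_cases i
  · simp only [AlgHom.comp_apply, Fin.zero_eta, aeval_X, Matrix.cons_val_zero, rhoPoly, reducedPair, map_sum,
      map_pow]
    refine Finset.sum_congr rfl fun j _ => ?_
    split_ifs <;> simp
  · simp only [AlgHom.comp_apply, Fin.mk_one, aeval_X, Matrix.cons_val_one, Matrix.cons_val_zero,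
      strainPoly, reducedPair, map_sum, map_mul, map_pow, aeval_C, algebraMap_eq]
    refine Finset.sum_congr rfl fun j _ => ?_
    split_ifs <;> simp

/-- Odd class: a first integral in a non-zero parity class vanishes. -/
theorem eq_zero_of_odd (ha : Function.Injective a) {P : MvPolynomial (Fin 3) ℝ} {ε : Par}
    (hP : IsWeightedHomogeneous wPar P ε) (hε : ε ≠ 0) (hL : topL a P = 0) : P = 0 := by
  classical
  obtain ⟨i₀, hi₀⟩ : ∃ i₀, ε i₀ ≠ 0 := Function.ne_iff.mp hε
  have hP2 : IsWeightedHomogeneous wPar (P * P) 0 := by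
    have h := hP.mul hP
    rwa [par_add_self] at h
  have hL2 : topL a (P * P) = 0 := by rw [topL_mul, hL, mul_zero, add_zero]
  obtain ⟨F, hF⟩ := exists_aeval_of_even ha hP2 hL2
  set g : Fin 3 → MvPolynomial (Fin 3) ℝ := fun j => if j = i₀ then 0 else X j with hg
  have hgP : aeval g P = 0 := aeval_eq_zero_of_odd hP hi₀ g (by simp [hg])
  have hgF : expand 2 (reducedPair a i₀ F) = 0 := by
    rw [← AlgHom.comp_apply, ← kill_comp_aeval, AlgHom.comp_apply, ← hF, map_mul, hgP, mul_zero]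
  have hF0 : F = 0 := reducedPair_injective ha i₀ (((expand_eq_zero two_pos).mp hgF).trans (map_zero _).symm)
  rw [hF0, map_zero] at hF
  exact mul_self_eq_zero.mp hF

end Chart

/-! ### A1 by name -/

/-- **A1 (ns-idea-15 «steady-centre-sieve», CentreJetSketch l.282): the polynomial first integrals of the Euler top
`W = y × S y` with pairwise distinct principal strains are exactly the polynomials in `|y|²` and `⟪y, S y⟫`.**
Kernel theorem BY NAME over the Theorems-side twin `EulerTopFirstIntegrals` (body verbatim). -/
theorem eulerTopFirstIntegrals : EulerTopFirstIntegrals := by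
  intro a ha T hT
  have hL : topL a T = 0 := by rw [topL_apply]; exact hT
  have hcls := topL_parityClass a hL
  obtain ⟨F, hF⟩ :=
    exists_aeval_of_even ha (weightedHomogeneousComponent_isWeightedHomogeneous (w := wPar) 0 T) (hcls 0)
  refine ⟨F, ?_⟩
  rw [← hF]
  conv_lhs => rw [← sum_parity_classes T]
  rw [Finset.sum_eq_single (0 : Par)]
  · intro ε _ hε
    exact eq_zero_of_odd ha (weightedHomogeneousComponent_isWeightedHomogeneous (w := wPar) ε T) hε (hcls ε)
  · intro h
    exact absurd (Finset.mem_univ _) h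

end Summit.NavierStokesRegularity.NavierStokesRegularity.Theorems.PoloidalLiouville.CentreJet

end
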